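import Summits.ResolutionOfSingularities.ResolutionOfSingularities.Theorems.FrobeniusLadderFInjectiveMacaulayficationFCForallExistsDimLe2
import Literature.AlgebraicGeometry.Resolution.LipmanTermination
import Literature.AlgebraicGeometry.Resolution.ResolutionOfCurves
import Literature.AlgebraicGeometry.Resolution.SurfaceResolutionReduction
import Literature.AlgebraicGeometry.Resolution.AlterationsNormalizationReduction
import Literature.AlgebraicGeometry.Resolution.BlowupsComposition
import Literature.AlgebraicGeometry.Resolution.BlowupsProduct
import Literature.AlgebraicGeometry.Resolution.BirationalLocalIso
import Literature.AlgebraicGeometry.Resolution.MarkedIdealsLemmas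
import HarnessLib

/-!
# A REGULAR BLOW-UP MODEL of every affine variety of dimension `≤ 2`, from Lipman's theorem and «a finite modification of a blowing
# up is a blowing up» — the engine of the W-line rung W2 (crux `FInjectiveMacaulayfication` stmt-ResolutionOfSingularities-15315,
# chain w45a; res-L1-w45a-plan-1 R13.41 (3); statement owner res-L1-w45a-strat-1 `H4LocRepairSig.lean` v1.2 §9′ R-W2; prover res-L1-w45a-stub-4)

[OURS · L1 W4.5a] Support file (`--supports stmt-ResolutionOfSingularities-15315 --as helper`); NOT a statement of any manuscript;
no definitions, no named fact introduced (Lipman 1978 is the tree's named fact `Lipman1978SequenceFinite`, taken as a hypothesis BY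
NAME; the folklore input S-V «a finite modification of a blowing up is a blowing up with the same support» is the tree's
`@[conjecture] def FCForallExistsDimLe2.FiniteModificationOfBlowupIsBlowup`, being discharged by res-L1-w45a-stub-7's
`FiniteModificationOfBlowup` / `FiniteModificationConductor*` files, and is taken as a hypothesis BY NAME); AI-written (AI review
is weaker than expert review).

THE POINT. Strat-1's R-W2 route asks for a PROJECTIVE regular model of the affine surface and Liu 2002 Thm. 8.1.24 (blow-up
presentation). We avoid projectivity altogether: Lipman's sequence «normalise; blow up the reduced singular locus; normalise; …»
(`NormalSurface.step`, `LipmanProcedure.lean`) is turned into ONE blowing up of the affine base link by link, using only the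
tree's composition of blow-ups (Stacks 080B, `IsBlowup.exists_isBlowup_comp`), the twist by an effective Cartier divisor
(`IsBlowup.mul_of_isEffectiveCartier`) and S-V for each normalisation. The invariant carried along the tower is
«`X_i → X₁` is a blowing up along a non-zero ideal sheaf `Q` off whose support the local rings of `X₁` are integrally closed»
(so that the next normalisation is an isomorphism off the support of the composite centre, as S-V demands).

* §1 plumbing: stalk maps of a restricted isomorphism, surjectivity of closed dominant maps, a blow-up with non-empty source has
  non-zero centre, the stalk map of a blow-up off the centre's support.
* §2 `exists_isBlowup_normalizationι` — FIRST LINK: the normalisation of an affine variety `X₁` IS a blowing up of `X₁` along a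
  non-zero ideal sheaf off whose support `X₁` is normal (centre := S-V applied to the identity blow-up of a principal ideal `(x)`
  with `D(x)` inside a normal affine open, `ResolutionOfCurves.exists_isAffineOpen_isIntegrallyClosed`).
* §3 `exists_isBlowup_step` — THE LINK: if `ρ : S.X → X₁` (`S` a normal surface) is such a blowing up then so is
  `S.stepπ ≫ ρ` (Stacks 080B + twist + S-V on `normalizationι (singBlowup …)`, which is an isomorphism off the composite centre by
  `BirationalLocalIso.isIso_morphismRestrict_of_isIntegralHom_of_normal`).
* §4 `exists_regular_isBlowup_of_lipman` — for an affine integral `k`-scheme of finite type of dimension `≤ 2` there are a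
  REGULAR `Y`, `π : Y → X₁` and `J ≠ ⊥` with `IsBlowup π J` (dimension `≤ 1`: the normalisation is regular; dimension `2`:
  induction along `NormalSurface.step^[n]`, generalising the surface as in `NormalSurface.hasResolution_of_iterate`).

[folklore assembly; cite: Liu2002, Thm. 8.3.44 (PDF p. 427); StacksProject, Tags 080A, 080B, 02OS; GortzWedhorn2020, Def. 13.90 and (13.19)]
-/

-- single-problem summit: the doubled namespace component is forced
set_option linter.dupNamespace false

noncomputable section

open AlgebraicGeometry CategoryTheory Literature.AlgebraicGeometry.Resolution TopologicalSpace

namespace Summit.ResolutionOfSingularities.ResolutionOfSingularities.Theorems.FInjectiveMacaulayfication.RegularBlowupModelDim2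

open Summit.ResolutionOfSingularities.ResolutionOfSingularities.Theorems.FInjectiveMacaulayfication
open Summit.ResolutionOfSingularities.ResolutionOfSingularities.Theorems.FInjectiveMacaulayfication.FCForallExistsDimLe2

/-! ## §1 Plumbing -/

/-- The stalk maps of a morphism that restricts to an isomorphism over an open `U` are isomorphisms at the points over `U`
(adapted from `IsBlowup.isIso_stalkMap_of_not_mem_support`, `MonomialOrderReductionUnit.lean`). [folklore] -/
theorem isIso_stalkMap_of_isIso_morphismRestrict {X Y : Scheme.{0}} (f : X ⟶ Y) (U : Y.Opens) [IsIso (f ∣_ U)]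
    (x : X) (hx : f.base x ∈ U) : IsIso (f.stalkMap x) := by
  have hxU : x ∈ f ⁻¹ᵁ U := hx
  haveI : IsOpenImmersion ((f ⁻¹ᵁ U).ι ≫ f) := by
    rw [← morphismRestrict_ι]; infer_instance
  have h1 : IsIso (((f ⁻¹ᵁ U).ι ≫ f).stalkMap ⟨x, hxU⟩) :=
    ((IsOpenImmersion.iff_isIso_stalkMap (f := (f ⁻¹ᵁ U).ι ≫ f)).mp inferInstance).2 _
  haveI h2 : IsIso (((f ⁻¹ᵁ U).ι).stalkMap ⟨x, hxU⟩) :=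
    ((IsOpenImmersion.iff_isIso_stalkMap (f := (f ⁻¹ᵁ U).ι)).mp inferInstance).2 _
  rw [Scheme.Hom.stalkMap_comp] at h1
  exact @IsIso.of_isIso_comp_right _ _ _ _ _ (f.stalkMap x) (((f ⁻¹ᵁ U).ι).stalkMap ⟨x, hxU⟩) h2 h1

/-- Over an open `U` over which `f` restricts to an isomorphism, every point of `U` has a preimage. [folklore] -/
theorem exists_preimage_of_isIso_morphismRestrict {X Y : Scheme.{0}} (f : X ⟶ Y) (U : Y.Opens) [IsIso (f ∣_ U)]
    (y : Y) (hy : y ∈ U) : ∃ x : X, f.base x = y := by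
  obtain ⟨z, hz⟩ := (ConcreteCategory.bijective_of_isIso (f ∣_ U).base).2 ⟨y, hy⟩
  refine ⟨(f ⁻¹ᵁ U).ι.base z, ?_⟩
  have := morphismRestrict_base_coe f U z
  rw [hz] at this
  exact this.symm

/-- A universally closed dominant morphism is surjective. [folklore] -/
theorem surjective_of_universallyClosed_of_isDominant {X Y : Scheme.{0}} (f : X ⟶ Y) [UniversallyClosed f] [IsDominant f] :
    Function.Surjective f.base := by
  have hcl : IsClosed (Set.range f.base) := f.isClosedMap.isClosed_range
  have hd : Dense (Set.range f.base) := f.denseRange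
  intro y
  have : y ∈ Set.range f.base := by
    rw [← hcl.closure_eq, hd.closure_eq]
    exact Set.mem_univ y
  exact this

/-- The centre of a blowing up with integral (hence non-empty) source is non-zero. [folklore] -/
theorem ne_bot_of_isBlowup {X' X : Scheme.{0}} {π : X' ⟶ X} {Q : X.IdealSheafData} (hπ : IsBlowup π Q) [IsIntegral X'] :
    Q ≠ ⊥ := by
  rintro rfl
  obtain ⟨x'⟩ := (inferInstance : Nonempty X')
  obtain ⟨U, hxU, f, hf, hU⟩ := hπ.isEffectiveCartier x'
  haveI : Nonempty (U : X'.Opens) := ⟨⟨x', hxU⟩⟩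
  rw [Scheme.IdealSheafData.comap_bot, Scheme.IdealSheafData.ideal_bot, Pi.bot_apply, eq_comm,
    Ideal.span_singleton_eq_bot] at hU
  rw [hU] at hf
  exact absurd rfl (nonZeroDivisors.ne_zero hf)

/-- Off the support of its centre a blowing up has isomorphic stalks (Stacks 02OS). [folklore] -/
theorem isIso_stalkMap_of_isBlowup_of_not_mem {X' X : Scheme.{0}} {π : X' ⟶ X} {Q : X.IdealSheafData} (hπ : IsBlowup π Q)
    (x' : X') (hx : π.base x' ∉ (Q.support : Set X)) : IsIso (π.stalkMap x') := by
  haveI : IsIso (π ∣_ ⟨(Q.support : Set X)ᶜ, Q.support.isClosed.isOpen_compl⟩) := hπ.isIso_compl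
  exact isIso_stalkMap_of_isIso_morphismRestrict π ⟨(Q.support : Set X)ᶜ, Q.support.isClosed.isOpen_compl⟩ x' hx

/-- Off the support of its centre every point has a preimage under a blowing up. [folklore] -/
theorem exists_preimage_of_isBlowup_of_not_mem {X' X : Scheme.{0}} {π : X' ⟶ X} {Q : X.IdealSheafData} (hπ : IsBlowup π Q)
    (x : X) (hx : x ∉ (Q.support : Set X)) : ∃ x' : X', π.base x' = x := by
  haveI : IsIso (π ∣_ ⟨(Q.support : Set X)ᶜ, Q.support.isClosed.isOpen_compl⟩) := hπ.isIso_compl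
  exact exists_preimage_of_isIso_morphismRestrict π ⟨(Q.support : Set X)ᶜ, Q.support.isClosed.isOpen_compl⟩ x hx

/-- **Twist by a divisor that is Cartier UPSTAIRS** (variant of `IsBlowup.mul_of_isEffectiveCartier`, Stacks 080B): a blowing up
`π` of `X` along `K` is also a blowing up along `K · L` as soon as `π⁻¹L 𝒪_{X'}` is an effective Cartier divisor (a morphism
inverting `K · L` inverts `K`, Tag 07ZV). [folklore] -/
theorem isBlowup_mul_of_comap {X' X : Scheme.{0}} {π : X' ⟶ X} {K L : X.IdealSheafData} (hπ : IsBlowup π K)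
    (hL : IsEffectiveCartier (L.comap π)) : IsBlowup π (K * L) := by
  constructor
  · rw [comap_mul]
    exact hπ.isEffectiveCartier.mul hL
  · intro W f hf
    rw [comap_mul] at hf
    exact hπ.universal f hf.of_mul_left

/-! ## §2 The first link: the normalisation of an affine variety is a blowing up -/

/-- **The normalisation of an affine variety is a blowing up of a non-zero ideal sheaf, off whose support the variety is normal**
(modulo S-V). Route: a normal affine open `W` (`exists_isAffineOpen_isIntegrallyClosed`), a basic open `D(x) ⊆ W` of the affine
`X₁` (`x ≠ 0`), the identity blow-up of the effective Cartier divisor `(x)` (`IsBlowup.id`), and S-V for the finite surjective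
normalisation, which is a stalk isomorphism over `D(x)` (`isIso_normalizationι_morphismRestrict`). [folklore] -/
theorem exists_isBlowup_normalizationι (hV : FiniteModificationOfBlowupIsBlowup) {k : Type} [Field k] (X₁ : Scheme.{0})
    (f₁ : X₁ ⟶ Spec (.of k)) [LocallyOfFiniteType f₁] [QuasiCompact f₁] [IsIntegral X₁] [IsAffine X₁] :
    ∃ Q : X₁.IdealSheafData, Q ≠ ⊥ ∧ IsBlowup (normalizationι X₁) Q ∧
      ∀ y : X₁, y ∉ (Q.support : Set X₁) → IsIntegrallyClosed (X₁.presheaf.stalk y) := by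
  haveI : IsLocallyNoetherian X₁ := LocallyOfFiniteType.isLocallyNoetherian f₁
  haveI : IsNoetherian X₁ := ⟨⟩
  -- a normal affine open `W` and a basic open `D(x) ⊆ W`
  obtain ⟨W, hW, ⟨w, hwW⟩, hic⟩ := exists_isAffineOpen_isIntegrallyClosed X₁ NoetherFiniteIntegralClosure_holds f₁
  haveI hνW : IsIso (normalizationι X₁ ∣_ W) := isIso_normalizationι_morphismRestrict X₁ hW ⟨w, hwW⟩ hic
  obtain ⟨x, hxW, hwx⟩ := (isAffineOpen_top X₁).exists_basicOpen_le ⟨w, hwW⟩ (Set.mem_univ w)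
  -- the principal ideal sheaf `(x)`, its support `X₁ ∖ D(x)`, and its effective-Cartier-ness
  set Q₀ : X₁.IdealSheafData := Scheme.IdealSheafData.ofIdealTop (Ideal.span {x}) with hQ₀def
  have hsupp : ∀ y : X₁, y ∉ (Q₀.support : Set X₁) ↔ y ∈ X₁.basicOpen x := by
    intro y
    rw [hQ₀def, Scheme.IdealSheafData.coe_support_ofIdealTop, Scheme.zeroLocus_span, Scheme.zeroLocus_singleton,
      Set.mem_compl_iff, not_not, SetLike.mem_coe]
  have hx0 : x ≠ 0 := by
    rintro rfl
    rw [Scheme.basicOpen_zero] at hwx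
    exact hwx
  have hcart : IsEffectiveCartier Q₀ := by
    intro y
    refine ⟨⟨⊤, isAffineOpen_top X₁⟩, Set.mem_univ y, x, ?_, ?_⟩
    · haveI : Nonempty (⊤ : X₁.Opens) := ⟨⟨w, Set.mem_univ w⟩⟩
      exact mem_nonZeroDivisors_of_ne_zero hx0
    · rw [hQ₀def, Scheme.IdealSheafData.ofIdealTop_ideal]
      have e : (homOfLE (le_top : ((⟨⊤, isAffineOpen_top X₁⟩ : X₁.affineOpens) : X₁.Opens) ≤ ⊤)) = 𝟙 _ :=
        Subsingleton.elim _ _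
      rw [e, op_id, CategoryTheory.Functor.map_id, CommRingCat.hom_id, Ideal.map_id]
  have hid : IsBlowup (𝟙 X₁) Q₀ := IsBlowup.id hcart
  have hQ₀ : Q₀ ≠ ⊥ := ne_bot_of_isBlowup hid
  -- S-V for the finite surjective normalisation, a stalk isomorphism over `D(x) ⊆ W`
  haveI hfin : IsFinite (normalizationι X₁) := isFinite_normalizationι X₁ NoetherFiniteIntegralClosure_holds f₁
  have hsurj : Function.Surjective (normalizationι X₁).base := surjective_of_universallyClosed_of_isDominant _
  have hiso : ∀ x₃ : normalization X₁, (𝟙 X₁ : X₁ ⟶ X₁).base ((normalizationι X₁).base x₃) ∉ (Q₀.support : Set X₁) →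
      IsIso ((normalizationι X₁).stalkMap x₃) := by
    intro x₃ hx₃
    have h' : (normalizationι X₁).base x₃ ∉ (Q₀.support : Set X₁) := by simpa using hx₃
    exact isIso_stalkMap_of_isIso_morphismRestrict (normalizationι X₁) W x₃ (hxW ((hsupp _).mp h'))
  obtain ⟨J, hJ, hJsupp, hJbl⟩ := hV X₁ X₁ (normalization X₁) Q₀ (𝟙 X₁) (normalizationι X₁) inferInstance inferInstance hQ₀ hid
    inferInstance hfin hsurj hiso
  refine ⟨J, hJ, by simpa using hJbl, fun y hy => ?_⟩
  -- normality of `X₁` off `supp J = X₁ ∖ D(x)`: transport from the normalisation along the stalk isomorphism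
  rw [hJsupp] at hy
  have hyW : y ∈ W := hxW ((hsupp y).mp hy)
  obtain ⟨x₃, rfl⟩ := exists_preimage_of_isIso_morphismRestrict (normalizationι X₁) W y hyW
  haveI := isIso_stalkMap_of_isIso_morphismRestrict (normalizationι X₁) W x₃ hyW
  haveI := isIntegrallyClosed_stalk_normalization X₁ x₃
  exact IsIntegrallyClosed.of_equiv (asIso ((normalizationι X₁).stalkMap x₃)).commRingCatIsoToRingEquiv.symm


/-! ## §3 The link: one step of Lipman's sequence keeps «blowing up of `X₁` off whose centre `X₁` is normal» -/

/-- **THE LINK.** Let `S` be a normal surface over `k`, `ρ : S.X → X₁` a blowing up of the integral Noetherian `X₁` along `Q`, and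
suppose the local rings of `X₁` off `supp Q` are integrally closed. Then `S.stepπ ≫ ρ : X_{i+1} → X₁` («blow up the reduced
singular locus, then normalise», composed with `ρ`) is again a blowing up along a non-zero ideal sheaf off whose support `X₁`
is normal. (Stacks 080B for `Bl_{Sing} S.X → S.X → X₁`; twist by the effective Cartier divisor `Q𝒪`; the blow-up is then an
isomorphism onto NORMAL points off the composite centre, so the normalisation is an isomorphism there
(`isIso_morphismRestrict_of_isIntegralHom_of_normal`) and S-V applies.) [folklore assembly] -/
theorem exists_isBlowup_step (hV : FiniteModificationOfBlowupIsBlowup) {k : Type} [Field k] (S : NormalSurface k)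
    (X₁ : Scheme.{0}) [IsIntegral X₁] [IsNoetherian X₁] (ρ : S.X ⟶ X₁) (Q : X₁.IdealSheafData) (hρ : IsBlowup ρ Q)
    (hN : ∀ y : X₁, y ∉ (Q.support : Set X₁) → IsIntegrallyClosed (X₁.presheaf.stalk y)) :
    ∃ Q' : X₁.IdealSheafData, Q' ≠ ⊥ ∧ IsBlowup (S.stepπ ≫ ρ) Q' ∧
      ∀ y : X₁, y ∉ (Q'.support : Set X₁) → IsIntegrallyClosed (X₁.presheaf.stalk y) := by
  -- the blow-up of the reduced singular locus, the composite centre (Stacks 080B), twisted by `Q`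
  have hb : IsBlowup (singBlowup.π S.X S.hom) (singularLocusIdeal S.X S.hom) := blowup.isBlowup _
  obtain ⟨Q₀, hQ₀, -⟩ := hρ.exists_isBlowup_comp hb
  have hcart : IsEffectiveCartier (Q.comap (singBlowup.π S.X S.hom ≫ ρ)) := by
    rw [Scheme.IdealSheafData.comap_comp]
    exact IsEffectiveCartier.comap_of_isBlowup hb hρ.isEffectiveCartier
  have hQ'' : IsBlowup (singBlowup.π S.X S.hom ≫ ρ) (Q₀ * Q) := isBlowup_mul_of_comap hQ₀ hcart
  have hne : Q₀ * Q ≠ ⊥ := ne_bot_of_isBlowup hQ''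
  have hsub : ∀ y : X₁, y ∉ ((Q₀ * Q).support : Set X₁) → y ∉ (Q.support : Set X₁) := by
    intro y hy h
    apply hy
    rw [Scheme.IdealSheafData.support_mul, TopologicalSpace.Closeds.coe_sup]
    exact Or.inr h
  -- `X' = Bl_{Sing} S.X` is normal over the complement of `supp (Q₀·Q)`
  set c : singBlowup S.X S.hom ⟶ X₁ := singBlowup.π S.X S.hom ≫ ρ with hc
  let V : (singBlowup S.X S.hom).Opens := c ⁻¹ᵁ ⟨((Q₀ * Q).support : Set X₁)ᶜ, (Q₀ * Q).support.isClosed.isOpen_compl⟩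
  have hVn : ∀ y ∈ V, IsIntegrallyClosed ((singBlowup S.X S.hom).presheaf.stalk y) := by
    intro y hy
    have hy' : c.base y ∉ ((Q₀ * Q).support : Set X₁) := hy
    haveI := isIso_stalkMap_of_isBlowup_of_not_mem hQ'' y hy'
    haveI := hN _ (hsub _ hy')
    exact IsIntegrallyClosed.of_equiv (asIso (c.stalkMap y)).commRingCatIsoToRingEquiv
  -- hence the normalisation is an isomorphism over `V`
  have hgen : IsIso ((normalizationι (singBlowup S.X S.hom)).stalkMap (genericPoint (normalization (singBlowup S.X S.hom)))) :=
    (isBirational_normalizationι (singBlowup S.X S.hom) (singBlowup.π S.X S.hom ≫ S.hom)).isIso_stalkMap_genericPoint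
  haveI : IsIso (normalizationι (singBlowup S.X S.hom) ∣_ V) :=
    isIso_morphismRestrict_of_isIntegralHom_of_normal (normalizationι (singBlowup S.X S.hom)) hgen V hVn
  -- S-V
  have hsurj : Function.Surjective (normalizationι (singBlowup S.X S.hom)).base :=
    surjective_of_universallyClosed_of_isDominant _
  have hiso : ∀ x₃ : normalization (singBlowup S.X S.hom),
      c.base ((normalizationι (singBlowup S.X S.hom)).base x₃) ∉ ((Q₀ * Q).support : Set X₁) →
      IsIso ((normalizationι (singBlowup S.X S.hom)).stalkMap x₃) :=
    fun x₃ hx₃ => isIso_stalkMap_of_isIso_morphismRestrict (normalizationι (singBlowup S.X S.hom)) V x₃ hx₃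
  obtain ⟨J, hJ, hJsupp, hJbl⟩ := hV X₁ (singBlowup S.X S.hom) (normalization (singBlowup S.X S.hom)) (Q₀ * Q) c
    (normalizationι (singBlowup S.X S.hom)) inferInstance inferInstance hne hQ'' inferInstance inferInstance hsurj hiso
  refine ⟨J, hJ, ?_, fun y hy => hN y (hsub y (by rwa [hJsupp] at hy))⟩
  have e : S.stepπ ≫ ρ = normalizationι (singBlowup S.X S.hom) ≫ c := by
    rw [hc, ← Category.assoc]
    rfl
  rw [e]
  exact hJbl

/-! ## §4 A regular blow-up model of every affine variety of dimension `≤ 2` -/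

/-- **Tower induction** (on the length `n` of Lipman's sequence, generalising the surface, as in
`NormalSurface.hasResolution_of_iterate`): if `X_n = step^[n] S` is regular and `S.X → X₁` is a blowing up off whose centre `X₁`
is normal, then some regular `k`-scheme is a blowing up of `X₁` along a non-zero ideal sheaf. [folklore assembly] -/
theorem exists_regular_isBlowup_of_iterate (hV : FiniteModificationOfBlowupIsBlowup) {k : Type} [Field k]
    (X₁ : Scheme.{0}) [IsIntegral X₁] [IsNoetherian X₁] :
    ∀ (n : ℕ) (S : NormalSurface k) (ρ : S.X ⟶ X₁) (Q : X₁.IdealSheafData), IsBlowup ρ Q →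
      (∀ y : X₁, y ∉ (Q.support : Set X₁) → IsIntegrallyClosed (X₁.presheaf.stalk y)) →
      Scheme.IsRegular (NormalSurface.step^[n] S).X →
      ∃ (Y : Scheme.{0}) (_ : Y ⟶ Spec (.of k)) (π : Y ⟶ X₁) (J : X₁.IdealSheafData),
        J ≠ ⊥ ∧ IsBlowup π J ∧ Scheme.IsRegular Y := by
  intro n
  induction n with
  | zero =>
    intro S ρ Q hρ _ hreg
    exact ⟨S.X, S.hom, ρ, Q, ne_bot_of_isBlowup hρ, hρ, hreg⟩
  | succ n ih =>
    intro S ρ Q hρ hN hreg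
    rw [Function.iterate_succ_apply] at hreg
    obtain ⟨Q', -, hbl, hN'⟩ := exists_isBlowup_step hV S X₁ ρ Q hρ hN
    exact ih S.step (S.stepπ ≫ ρ) Q' hbl hN' hreg

/-- **A REGULAR BLOW-UP MODEL OF AN AFFINE VARIETY OF DIMENSION `≤ 2`** (modulo Lipman 1978 BY NAME and S-V BY NAME): for an affine
integral `k`-scheme `X₁` of finite type with `dim X₁ ≤ 2` there are a regular `k`-scheme `Y`, `π : Y → X₁` and a non-zero ideal
sheaf `J` on `X₁` with `IsBlowup π J`. Dimension `≤ 1`: `Y` = the normalisation (`isRegular_normalization_of_dim_le_one`);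
dimension `2`: Lipman's sequence on the normalisation (`Lipman1978SequenceFinite`) and the tower induction.
[cite: Liu2002, Thm. 8.3.44 (PDF p. 427)] -/
theorem exists_regular_isBlowup_of_lipman (hL : Lipman1978SequenceFinite.{0}) (hV : FiniteModificationOfBlowupIsBlowup)
    {k : Type} [Field k] (X₁ : Scheme.{0}) (f₁ : X₁ ⟶ Spec (.of k)) [IsSeparated f₁] [LocallyOfFiniteType f₁] [QuasiCompact f₁]
    [IsIntegral X₁] [IsAffine X₁] (hdim : topologicalKrullDim X₁ ≤ 2) :
    ∃ (Y : Scheme.{0}) (_ : Y ⟶ Spec (.of k)) (π : Y ⟶ X₁) (J : X₁.IdealSheafData),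
      J ≠ ⊥ ∧ IsBlowup π J ∧ Scheme.IsRegular Y := by
  haveI : IsLocallyNoetherian X₁ := LocallyOfFiniteType.isLocallyNoetherian f₁
  haveI : IsNoetherian X₁ := ⟨⟩
  obtain ⟨Q, hQ, hbl, hN⟩ := exists_isBlowup_normalizationι hV X₁ f₁
  haveI hfin : IsFinite (normalizationι X₁) := isFinite_normalizationι X₁ NoetherFiniteIntegralClosure_holds f₁
  rcases le_one_or_eq_two_of_le_two hdim with h1 | h2
  · exact ⟨normalization X₁, normalizationι X₁ ≫ f₁, normalizationι X₁, Q, hQ, hbl,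
      isRegular_normalization_of_dim_le_one X₁ NoetherFiniteIntegralClosure_holds f₁ h1⟩
  · let S : NormalSurface k :=
      { X := normalization X₁, hom := normalizationι X₁ ≫ f₁, isSeparated := inferInstance,
        locallyOfFiniteType := inferInstance, quasiCompact := inferInstance, isIntegral := inferInstance,
        normal := isIntegrallyClosed_stalk_normalization X₁,
        dim_eq := by rw [topologicalKrullDim_normalization X₁ f₁, h2] }
    obtain ⟨n, hn⟩ := hL k S
    exact exists_regular_isBlowup_of_iterate hV X₁ n S (normalizationι X₁) Q hbl hN hn

end Summit.ResolutionOfSingularities.ResolutionOfSingularities.Theorems.FInjectiveMacaulayfication.RegularBlowupModelDim2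

end
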